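import Mathlib
import HarnessLib
import Summits.HubbardSuperconductivity.HubbardSuperconductivity.Theorems.KLProgrammeKLRegimeSplitTwoLegIncrementSizes
import Summits.HubbardSuperconductivity.HubbardSuperconductivity.Theorems.KLProgrammeKLRegimeSplitTwoLegIncrementMomentsFromPosition

/-!
# Route `KLProgramme` — gen-5 ENGINE child, two-leg stubs: the ORDER-RESOLVED (E3a) tier-1 sizes of `ℓ_{n+1}(K.eval)` END TO END from the
# POSITION-SPACE increment kernel moments (k3c3-p3's `twoLegPieceV13_tier1_size_le` ∘ p1b's Fourier bridge)

Cell `gate-hubbard-kl`, seat p1b (g6).  k3c3-p3's `twoLegPieceV13_tier1_size_le` (`…TwoLegIncrementSizes`, p488152) is the tier-1 supplier of record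
(order-resolved: moments of order `≤ j` only, absolute curve constants `klCurveD1/klCurveD2`, centred profile by slope — β-free fit; see its docstring
and the caution on the coarse `…TwoLegSizesFromPosition`).  Its input `hm` — the coefficient moments `m k` of the increment data `σ_{n+1} − σ_n` — is
exactly the output of `sum_weight_abs_torusCosCoeff_klLocSelfEnergyRe_sub_le` (`…TwoLegIncrementMomentsFromPosition`, p486520) with `m k = 2·Mˢ k`,
`Mˢ k` the pinned spatial `k`-th moment of the increment `W^{(n+1)} − W^{(n)}` of the unsectorised position two-leg kernels.  Composed here:
**`twoLegPieceV13_tier1_size_le_of_position_moments`** — the (E3a) tier-1 sizes of `ℓ_{n+1}(K.eval)`, `j ≤ 2`, from position-space data alone,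
order-resolved.  Proof only; nothing about the model is asserted.  References: BGM 2006 (2.36) [cite: BenfattoGiulianiMastropietro2006].
-/

noncomputable section

namespace Summit.HubbardSuperconductivity.HubbardSuperconductivity.Theorems.KLRegimeSplit

set_option linter.dupNamespace false -- summit = problem name (single-conjunct summit), D-0017

open Real Finset
open Literature.MathematicalPhysics.QuantumLattice Literature.Probability.LatticeModels
open Summit.HubbardSuperconductivity.HubbardSuperconductivity.Theorems.KLProgrammeLegKernels
open Summit.HubbardSuperconductivity.HubbardSuperconductivity.Theorems.TwoLegFourier
open Summit.HubbardSuperconductivity.HubbardSuperconductivity.Theorems.PerturbedFermiCurve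

variable {L M : ℕ} [NeZero L] [NeZero M]

/-- **(E3a) tier 1 of `ℓ_{n+1}(K.eval)`, ORDER-RESOLVED, FROM POSITION-SPACE INCREMENT MOMENTS.**  In the regime (`c ≤ klCurveC3 R`, `U ≤ klCurveU0 R`,
`klBetaMin ≤ β ≤ e^{c/U²}`), `μ ∈ klWindowC`, `K` admissible; pinned spatial moments `Mˢ k` (`k ≤ 4`) of the increment `W_σ^{(n+1)} − W_σ^{(n)}` of the
unsectorised position two-leg kernels; cutoff numerals `X` (`l ≤ j`).  Then for `j ≤ 2`:
`‖Dʲ onM ℓ_{n+1}(K.eval)(q)‖ ≤ [j=0]·2Mˢ₀ + (j!)²(2·j!·X·200ʲ)·G_j·(4 + max 1 ((j−1)!/(8/5)))ʲ` with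
`G₀ = 4Mˢ₀`, `G₁ = (2π+1)·2Mˢ₁·klCurveD1`, `G₂ = G₁ + 2Mˢ₂·klCurveD1² + 2Mˢ₁·klCurveD2` (k3c3-p3's per-order `G`, `m k = 2Mˢ k`). -/
theorem twoLegPieceV13_tier1_size_le_of_position_moments {R : RenConsts} (hR : ∀ j, 0 ≤ R.Gfr j) {c : ℝ} (hc : 0 < c)
    (hcle : c ≤ klCurveC3 R) {U : ℝ} (hU : 0 < U) (hUle : U ≤ klCurveU0 R) {β : ℝ} (hβmin : klBetaMin ≤ β)
    (hβc : β ≤ Real.exp (c / U ^ 2)) {μ : ℝ} (hμ : μ ∈ klWindowC) {K : TrigPolyC4v} (hK : FrameOK R U (nScales β) μ K) (n : ℕ)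
    {Ms : ℕ → ℝ}
    (hMs : ∀ k ≤ 4, ∀ (σ : Fin 2) (x₀ : SpaceTimeIdx L M), imagTimeWeight β M *
      ∑ x ∈ (univ : Finset (Fin 2 → SpaceTimeIdx L M)).filter (fun x => x 0 = x₀),
        (1 + ((((x 1).2 - (x 0).2) 0).valMinAbs.natAbs : ℝ) + ((((x 1).2 - (x 0).2) 1).valMinAbs.natAbs : ℝ)) ^ k *
          ‖sectorisedKernel L M β (trivialMultiplier L M) (klEffectiveAction L M β U μ K klE0 (n + 1)) 2
              (![((0, σ), 0), ((0, σ), 1)] : Fin 2 → SectorLeg 1) x -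
            sectorisedKernel L M β (trivialMultiplier L M) (klEffectiveAction L M β U μ K klE0 n) 2
              (![((0, σ), 0), ((0, σ), 1)] : Fin 2 → SectorLeg 1) x‖ ≤ Ms k)
    {j : ℕ} (hj : j ≤ 2) {X : ℝ} (hX : ∀ l ≤ j, ∀ x : ℝ, ‖iteratedFDeriv ℝ l salmhoferCutoff x‖ ≤ X) (q : Momentum) :
    ‖iteratedFDeriv ℝ j (onM (klTwoLegPieceFn L M β U μ K.eval (n + 1))) q‖ ≤
      (if j = 0 then 2 * Ms 0 else 0) +
        (j.factorial : ℝ) ^ 2 * (2 * j.factorial * X * 200 ^ j) *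
          (if j = 0 then 2 * (2 * Ms 0) else (2 * π + 1) * (2 * Ms 1 * klCurveD1) +
            (if j = 2 then 2 * Ms 2 * klCurveD1 ^ 2 + 2 * Ms 1 * klCurveD2 else 0)) *
          (4 + max 1 (((j - 1).factorial : ℝ) / (8 / 5))) ^ j := by
  have hβ : 0 < β := lt_of_lt_of_le (by unfold klBetaMin; norm_num) hβmin
  exact twoLegPieceV13_tier1_size_le (L := L) (M := M) hR hc hcle hU hUle hβmin hβc hμ hK n (m := fun k => 2 * Ms k)
    (fun k hk => sum_weight_abs_torusCosCoeff_klLocSelfEnergyRe_sub_le hβ U μ K n k (hMs k hk)) hj hX q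

end Summit.HubbardSuperconductivity.HubbardSuperconductivity.Theorems.KLRegimeSplit

end
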